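import Summits.BirchSwinnertonDyer.BirchSwinnertonDyer.Theorems.SylvesterTwoHeegnerIndexUpperOnV0
import HarnessLib

/-!
# Crux 19476 / children 19580–19582 (route `SylvesterTwoHeegnerIndex` rev 8): the `𝒱₀` layer and the
# glue need only the `2`-INTEGRALITY of `#Ш_an(E_p)·#Ш_an(E_{3p²})`, not its evenness

HONEST FRAMING (cell «bsd-cm», D-0074 seat `bsd-cm-k7t-c2` gen 2). The D98 split filed the binder
`TwoAdicPairHSY` (19580: `ord₂ (#Ш_an(E_p)·#Ш_an(E_{3p²})) = 2n`, the cell's refereed Thm B′/B″ + C) and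
the glue 19582 (`TwoAdicPairHSY → UpperOffV0HSY → HeegnerIndexUpperAtTwoHSYOfFacts`, closed on
`upperOfFacts_of_twoAdicPair_of_offV0`). This file records, sorry-free, that the glue consumes ONLY the
NONNEGATIVITY `0 ≤ ord₂ (#Ш_an(E_p)·#Ш_an(E_{3p²}))` («the product of the two analytic Ш-orders is a
`2`-adic integer» — memo two: odd-index lemma for `p ≡ 4 (9)`, plus Thm C for `p ≡ 7 (9)`; the
evenness is Cor B1 and is not needed for the UPPER half):

* `twoIntegralPair_of_twoAdicPair` — `TwoAdicPairHSY` ⇒ the weaker integrality binder (so nothing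
  below is stronger than what the route already has);
* `upperOfFacts_of_twoIntegralPair_of_offV0` — the `𝒱₀` layer (inlined: `0 + 0 ≤ ord₂ (qB·qA)`) and
  the glue from the integrality binder + `UpperOffV0HSY`'s body: a drop-in replacement for 19582's proof term should the planner ever weaken 19580 to
  integrality (OPTION, not a request; no item is touched here).

Both binders are displayed hypotheses (OPEN in the kernel); nothing is asserted; no label moves.
References: [HuShuYin2019] (bsd) p. 12; [Miller2011LMS] Def. 1.1; parent `…UpperOnV0.lean` (p431798).
-/

set_option autoImplicit false
set_option linter.dupNamespace false

noncomputable section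

open scoped Classical

open WeierstrassCurve NumberField Literature.NumberTheory.EllipticCurves
  Literature.NumberTheory.EllipticCurves.Rank1Residual
  Literature.NumberTheory.EllipticCurves.Rank1Residual.Typed
  Literature.NumberTheory.EllipticCurves.HuShuYin2019
  Summit.BirchSwinnertonDyer.Rank1Residual
  Summit.BirchSwinnertonDyer.BirchSwinnertonDyer.Theses.SylvesterTwoHeegnerIndex

namespace Summit.BirchSwinnertonDyer.BirchSwinnertonDyer.Theorems.SylvesterTwoUpper

/-- **`TwoAdicPairHSY` (19580) ⇒ the integrality binder**: `ord₂ (qB·qA) = 2n ⇒ 0 ≤ ord₂ (qB·qA)`.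
Bookkeeping. [folklore] -/
theorem twoIntegralPair_of_twoAdicPair (hBC : TwoAdicPairHSY) :
    ∀ (p : ℕ), p.Prime → (p % 9 = 4 ∨ p % 9 = 7) → (¬ ∃ x : ZMod p, x ^ 3 = 3) →
      ∀ (A B : WeierstrassCurve ℚ) [A.IsElliptic] [A.IsGloballyMinimal] [B.IsElliptic]
        [B.IsGloballyMinimal], (∃ C : VariableChange ℚ, C • B = cubeSumCurve (p : ℚ)) →
        (∃ C : VariableChange ℚ, C • A = cubeSumCurve (3 * (p : ℚ) ^ 2)) →
        ∃ qB qA : ℚ, shaAn B = (qB : ℂ) ∧ shaAn A = (qA : ℂ) ∧ qB * qA ≠ 0 ∧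
          0 ≤ padicValRat 2 (qB * qA) := by
  intro p hp h9 h3 A B _ _ _ _ hB hA
  obtain ⟨qB, qA, hqB, hqA, hne, n, hn⟩ := hBC p hp h9 h3 A B hB hA
  exact ⟨qB, qA, hqB, hqA, hne, by rw [hn]; positivity⟩

section IntegralBinder

/-! ### The integrality binder (displayed once, as a section hypothesis): for all members/partners,
`#Ш_an(B)·#Ш_an(A)` is a nonzero rational with `0 ≤ ord₂`. NOT in print as such; memo two Thm B (B-i) +
odd-index lemma (+ Thm C for `p ≡ 7 (9)`). -/

variable
  (hBI : ∀ (p : ℕ), p.Prime → (p % 9 = 4 ∨ p % 9 = 7) → (¬ ∃ x : ZMod p, x ^ 3 = 3) →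
    ∀ (A B : WeierstrassCurve ℚ) [A.IsElliptic] [A.IsGloballyMinimal] [B.IsElliptic]
      [B.IsGloballyMinimal], (∃ C : VariableChange ℚ, C • B = cubeSumCurve (p : ℚ)) →
      (∃ C : VariableChange ℚ, C • A = cubeSumCurve (3 * (p : ℚ) ^ 2)) →
      ∃ qB qA : ℚ, shaAn B = (qB : ℂ) ∧ shaAn A = (qA : ℂ) ∧ qB * qA ≠ 0 ∧
        0 ≤ padicValRat 2 (qB * qA))

include hBI

/-- **GLUE from `2`-integrality + the OFF-`𝒱₀` piece** (the body of `UpperOffV0HSY`, 19581): the Upper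
twin `HeegnerIndexUpperAtTwoHSYOfFacts` follows — same case split as p431798's
`upperOfFacts_of_twoAdicPair_of_offV0`, with the weaker binder; the `𝒱₀` case is `0 + 0 ≤ ord₂ (qB·qA)` through p431591's
`missingUpperBoundAt_iff_pairBound`. Composition only; both inputs OPEN.
[cite: Kolyvagin1990, Thm. A] [cite: HuShuYin2019, (bsd) p. 12] [cite: SilvermanAEC2009, VIII.8 Cor. 8.3] -/
theorem upperOfFacts_of_twoIntegralPair_of_offV0 (hoff : UpperOffV0HSY) :
    HeegnerIndexUpperAtTwoHSYOfFacts := by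
  rw [upperOfFacts_iff_missingUpperBoundAt]
  intro hF p hp h9 h3 B _ _ hB
  have hF' := hF
  obtain ⟨hHSY, hCM0, hmod, -⟩ := hF'
  have hn : (3 * (p : ℚ) ^ 2) ≠ 0 :=
    mul_ne_zero (by norm_num) (pow_ne_zero _ (Nat.cast_ne_zero.mpr hp.ne_zero))
  haveI := X12.CubeSumFamilies.isElliptic_cubeSumCurve hn
  obtain ⟨A, _, _, CA, hCA⟩ :=
    X12.CubeSumFamilies.exists_isGloballyMinimal_model (cubeSumCurve (3 * (p : ℚ) ^ 2))
  by_cases hV0 : Nat.card (AddCommGroup.primaryComponent B.sha 2) = 1 ∧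
      Nat.card (AddCommGroup.primaryComponent A.sha 2) = 1
  · -- the `𝒱₀` layer from `2`-integrality alone: `0 + 0 ≤ ord₂ (qB·qA)`
    obtain ⟨qB, qA, hqB, hqA, hne, h0⟩ := hBI p hp h9 h3 A B hB ⟨CA, hCA⟩
    refine (missingUpperBoundAt_iff_pairBound hHSY hCM0 hmod hp h9 h3 A B hB ⟨CA, hCA⟩).mpr
      ⟨qB, qA, hqB, hqA, hne, ?_⟩
    rw [hV0.1, hV0.2]
    simpa only [padicValNat_one_right, Nat.cast_zero, add_zero] using h0
  · exact hoff hF p hp h9 h3 A B hB ⟨CA, hCA⟩ hV0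

end IntegralBinder

/-- **Sanity: the route's own pair recovers p431798's glue** — `TwoAdicPairHSY → UpperOffV0HSY →
HeegnerIndexUpperAtTwoHSYOfFacts` through the integrality binder (so 19582's statement is also proved
by this weaker road). [folklore] -/
theorem upperOfFacts_of_twoAdicPair_of_upperOffV0 (hBC : TwoAdicPairHSY) (hoff : UpperOffV0HSY) :
    HeegnerIndexUpperAtTwoHSYOfFacts :=
  upperOfFacts_of_twoIntegralPair_of_offV0 (twoIntegralPair_of_twoAdicPair hBC) hoff

end Summit.BirchSwinnertonDyer.BirchSwinnertonDyer.Theorems.SylvesterTwoUpper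

end
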